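import Summits.Langlands.Langlands.Theses.NonParallelVoid
import Literature.NumberTheory.GaloisRepresentations.AbsIrreducibleIndexTwo
import Literature.RepresentationTheory.Semisimple.IrreducibleOfCharpoly

/-!
# `TwistedInductionParallel` (crux stmt-Langlands-17000, route `NonParallelVoid`): the hypotheses
# `ρ.toGaloisRep.IsIrreducible` and "de Rham at `v ∣ p`" are REDUNDANT
# (negative-side support, refuter cdisprove seat; load-bearing analysis, sorry-free)

The crux quantifies over continuous `ρ : Γ_F → GL₂(ℚ̄_p)` (`F` imaginary quadratic) with, among
others, the binder `hirr : ρ.toGaloisRep.IsIrreducible`, the conjunct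
`(fontainePstAdicCompletion v p hv).IsDeRhamFramed (ρ.toLocal v)` of its Hodge hypothesis, and — in
its good-regime hypothesis — crystallinity at every `v ∣ p` and absolute irreducibility of a
reduction of `ρ|Γ_(F(ζ_p))`.  We record, kernel-checked, that the first two carry no information
beyond the last two:

* `isIrreducible_of_isResiduallyAbsIrreducible_restrictField` — for every field `K`, extension `L/K`,
  prime `ℓ` and `n ≥ 1`: if `ρ|Γ_L` is residually absolutely irreducible then `ρ` is irreducible
  (accepted bridge `FramedGaloisRep.IsResiduallyAbsIrreducible.isAbsolutelyIrreducible`, Burnside;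
  then an irreducible restriction forces irreducibility,
  `Representation.isIrreducible_of_isIrreducible_comp`).  (Darmon–Diamond–Taylor 1995, §2.1;
  Curtis–Reiner (27.4).)
* `twistedInductionParallel_iff_without_isIrreducible_isDeRham` — hence the crux is EQUIVALENT to the
  same statement with the binder `ρ.toGaloisRep.IsIrreducible →` deleted and the de Rham conjunct of
  the Hodge hypothesis deleted (crystalline ⇒ de Rham is the structure axiom
  `PstWeilDeligneData.IsCrystallineFramed.isDeRhamFramed` of the pinned datum).  Stated inline; no
  proposition is defined under `Summits/`.

Moral for provers / planners of line `symmetrise-pd-split`: no proof can use `hirr` or de Rham-ness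
"essentially"; what is load-bearing is: imaginary QUADRATIC base (both words — see the crux
`Disproof.lean`, §3, for the real-quadratic and quartic-CM paper counterexamples), crystallinity with
two distinct labelled weights, residual absolute irreducibility over `F(ζ_p)`, the parity hypothesis,
and (for the lever, not for truth) `p ≥ 11` split.  This file does NOT refute the crux.
-/

noncomputable section

-- `Summit.Langlands.Langlands.…` repeats a namespace component by design (D-0017 nested layout).
set_option linter.dupNamespace false

namespace Summit.Langlands.Langlands.Theorems.TwistedInductionParallel.Negative

open scoped NumberField
open NumberField IsDedekindDomain Field Filter
open Literature.NumberTheory.GaloisRepresentations Literature.NumberTheory.PAdicHodge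

/-- **`ρ̄|Γ_L` absolutely irreducible ⇒ `ρ` irreducible** (`n ≥ 1`, coefficients `ℚ̄_ℓ`, any field
extension `L/K`): by the accepted Burnside bridge the restriction `ρ|Γ_L` is absolutely irreducible,
hence irreducible, and a representation with an irreducible restriction is irreducible (a
`Γ_K`-stable line is `Γ_L`-stable).  (Darmon–Diamond–Taylor 1995, §2.1; Curtis–Reiner (27.4).) -/
theorem isIrreducible_of_isResiduallyAbsIrreducible_restrictField {K : Type*} [Field K] {ℓ : ℕ}
    [Fact ℓ.Prime] {n : ℕ} (hn : 0 < n) (L : Type*) [Field L] [Algebra K L]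
    (ρ : FramedGaloisRep K (PadicAlgCl ℓ) n)
    (h : FramedGaloisRep.IsResiduallyAbsIrreducible (ρ.restrictField L)) :
    ρ.toGaloisRep.IsIrreducible :=
  Literature.RepresentationTheory.Semisimple.Representation.isIrreducible_of_isIrreducible_comp
    (FramedRep.toRepresentation ρ) (absGaloisRestrict K L).toMonoidHom
    (FramedGaloisRep.IsResiduallyAbsIrreducible.isAbsolutelyIrreducible hn h).isIrreducible

/-- **`hirr` and de Rham-ness are not load-bearing in `TwistedInductionParallel`.**  The route decl is
equivalent to the statement obtained from it by deleting the binder `ρ.toGaloisRep.IsIrreducible →`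
and the conjunct `IsDeRhamFramed (ρ.toLocal v)` of the Hodge hypothesis: irreducibility follows from
the residual clause of the good regime (`isIrreducible_of_isResiduallyAbsIrreducible_restrictField`
with `L = F(ζ_p)`), and de Rham-ness from its crystallinity clause
(`IsCrystallineFramed.isDeRhamFramed`). [folklore] -/
theorem twistedInductionParallel_iff_without_isIrreducible_isDeRham :
    Summit.Langlands.Langlands.Theses.NonParallelVoid.TwistedInductionParallel ↔
      ∀ (F : Type) [Field F] [NumberField F] [Algebra.IsQuadraticExtension ℚ F],
        NumberField.IsTotallyComplex F → ∀ (p : ℕ) [Fact p.Prime]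
        (ρ : FramedGaloisRep F (PadicAlgCl p) 2),
        (∀ᶠ v : HeightOneSpectrum (𝓞 F) in cofinite, ρ.IsUnramifiedAt v) →
        (∀ (v : HeightOneSpectrum (𝓞 F)) (hv : ((p : ℕ) : 𝓞 F) ∈ v.asIdeal),
          letI := (fontainePstAdicCompletion v p hv).algebra
          ∀ τ : v.adicCompletion F →ₐ[ℚ_[p]] PadicAlgCl p, ∃ a b : ℤ, a < b ∧
            ρ.labelledHodgeTateWeightsAt v (fontainePstAdicCompletion v p hv).algebra
              (fontainePstAdicCompletion v p hv).𝔅 τ.toRingHom = {a, b}) →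
        (11 ≤ p ∧
          (∃ v w : HeightOneSpectrum (𝓞 F), v ≠ w ∧ ((p : ℕ) : 𝓞 F) ∈ v.asIdeal ∧
            ((p : ℕ) : 𝓞 F) ∈ w.asIdeal) ∧
          (∀ (v : HeightOneSpectrum (𝓞 F)) (hv : ((p : ℕ) : 𝓞 F) ∈ v.asIdeal),
            (fontainePstAdicCompletion v p hv).IsCrystallineFramed (ρ.toLocal v)) ∧
          FramedGaloisRep.IsResiduallyAbsIrreducible (ρ.restrictField (CyclotomicField p F))) →
        (∀ (v : HeightOneSpectrum (𝓞 F)) (hv : ((p : ℕ) : 𝓞 F) ∈ v.asIdeal)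
          (w : HeightOneSpectrum (𝓞 F)) (hw : ((p : ℕ) : 𝓞 F) ∈ w.asIdeal),
          letI := (fontainePstAdicCompletion v p hv).algebra
          letI := (fontainePstAdicCompletion w p hw).algebra
          ∀ (τ : v.adicCompletion F →ₐ[ℚ_[p]] PadicAlgCl p)
            (σ : w.adicCompletion F →ₐ[ℚ_[p]] PadicAlgCl p) (a b a' b' : ℤ),
            ρ.labelledHodgeTateWeightsAt v (fontainePstAdicCompletion v p hv).algebra
                (fontainePstAdicCompletion v p hv).𝔅 τ.toRingHom = {a, b} → a < b →
            ρ.labelledHodgeTateWeightsAt w (fontainePstAdicCompletion w p hw).algebra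
                (fontainePstAdicCompletion w p hw).𝔅 σ.toRingHom = {a', b'} → a' < b' →
            Even (b - a + (b' - a'))) →
        ∃ g : ℤ, ∀ (v : HeightOneSpectrum (𝓞 F)) (hv : ((p : ℕ) : 𝓞 F) ∈ v.asIdeal),
          letI := (fontainePstAdicCompletion v p hv).algebra
          ∀ τ : v.adicCompletion F →ₐ[ℚ_[p]] PadicAlgCl p, ∃ a : ℤ,
            ρ.labelledHodgeTateWeightsAt v (fontainePstAdicCompletion v p hv).algebra
              (fontainePstAdicCompletion v p hv).𝔅 τ.toRingHom = {a, a + g} := by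
  constructor
  · intro h F _ _ _ hF p _ ρ hunr hHT hG hE
    exact h F hF p ρ
      (isIrreducible_of_isResiduallyAbsIrreducible_restrictField two_pos _ ρ hG.2.2.2) hunr
      (fun v hv => ⟨(hG.2.2.1 v hv).isDeRhamFramed, hHT v hv⟩) hG hE
  · intro h F _ _ _ hF p _ ρ _ hunr hHT hG hE
    exact h F hF p ρ hunr (fun v hv => (hHT v hv).2) hG hE

end Summit.Langlands.Langlands.Theorems.TwistedInductionParallel.Negative
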